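import Mathlib
import Summits.Ventures.HodgeRepro2.Tier7.Line3.DiscreteProductCount

/-!
# Tier 7 — LINE 3 support: the compact factor — a discrete subgroup of `K × SL(2,ℝ)²` (`K` compact) and its
Poincaré series (`Line3/DiscreteCompactFactor.lean`; t7-L1-p1, gen 3; Mathlib + Line3/DiscreteProductCount)

The archimedean group of the line is `U(W_A)(F_∞) = U(2) × U(1,1) × U(1,1)` and the real lattice `Γ_N` is a discrete
subgroup of it (memo l. 86); `DiscreteProductCount` counts a discrete subgroup of the two `(1,1)`-factors
`SL(2,ℝ) × SL(2,ℝ)` alone. THIS FILE supplies the COMPACT FACTOR: for ANY compact group `K` and ANY subgroup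
`Γ ≤ K × SL(2,ℝ)²` with `1` isolated (`IsolatedOneTop Γ`: some neighbourhood of `1` meets `Γ` in `{1}` only),
* `Γ` has the discrete topology and is closed (`discreteTopology_of_isolated`, Mathlib's `Subgroup.isClosed_of_discrete`),
  so it meets every compact set in a finite set (`finite_inter_compact`: `IsCompact.finite`);
* the entrywise box `boxG₂` of radius `1` around `1` in `SL(2,ℝ)²` is compact (a closed embedding of `SL(2,ℝ)` into the
  matrix space, `isCompact_univ_pi`), so `Γ ∩ (K × boxG₂)` is finite and the projection `Γ.map snd ≤ SL(2,ℝ)²` has `1`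
  ISOLATED ENTRYWISE at some scale `ε₁ > 0` (`exists_isolated_snd`: `IsolatedOne₂ (Γ.map snd) ε₁`) — the hypothesis of
  `DiscreteProductCount`;
* the kernel `{γ ∈ Γ : γ.2 = 1} = Γ ∩ (K × {1})` is finite, of cardinality `m`, and every fibre of `Γ → Γ.map snd` is a coset
  of it, so the counts transfer with the factor `m` (`card_le_mul_card_image`, `count_compact_product`: the `hcount` shape
  with `β = 1 + ε'` for every `ε' > 0` in the size `psize ∘ snd`);
* hence the POINCARÉ SERIES of `Γ` on `K × SL(2,ℝ)²` converges absolutely and is continuous for every continuous `f` with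
  `‖f g‖ ≤ C (1 + psize g.2)^(−α)`, `α > 1` (`continuous_kernelSum_compact_product`, through `PoincareKernel`), in particular
  for the line's product test function `f₁(g.1) · f₂(g.2.1) · f₃(g.2.2)` with `f₁` bounded on the compact factor and `f₂, f₃`
  the `(1,1)`-place coefficients with the decay `(1 + κ)^(−α)` (`continuous_kernelSum_compact_product_three`; weight `3`:
  `α = 3/2`).
The only property of the lattice used is «`1` is isolated in `Γ`» in the archimedean group; the identification of the real
`U(2) × U(1,1) × U(1,1)` with `K × SL(2,ℝ)²` (`K = U(2)`; `U(1,1) = U(1)·SU(1,1)`, `SU(1,1) ≅ SL(2,ℝ)` by `cay`) and of the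
real test function with `f` stay the dictionary (TYPING-CENSUS T7); nothing about (N) or (P).
Sorry-free; axioms: propext / Classical.choice / Quot.sound. §8(d): uses an L-value-free non-vanishing device: NO.
-/

namespace Summit.Ventures.HodgeRepro2.Tier7.Line3.DiscreteCompactFactor

open MeasureTheory Metric Matrix Summit.Ventures.HodgeRepro2.Tier7.Line3.HyperbolicSize
  Summit.Ventures.HodgeRepro2.Tier7.Line3.DiscreteProductCount
open scoped MatrixGroups

noncomputable section

variable {K : Type} [TopologicalSpace K] [Group K] [IsTopologicalGroup K]

/-! ## 1. Isolation of `1`, discreteness, closedness, finiteness on compact sets -/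

/-- `1` is isolated in `Γ ≤ K × SL(2,ℝ)²`: some neighbourhood of `1` meets `Γ` only in `1` -/
def IsolatedOneTop (Γ : Subgroup (K × G₂)) : Prop := ∃ V ∈ nhds (1 : K × G₂), ∀ γ ∈ Γ, γ ∈ V → γ = 1

/-- a subgroup with `1` isolated carries the discrete topology -/
theorem discreteTopology_of_isolated {Γ : Subgroup (K × G₂)} (h : IsolatedOneTop Γ) : DiscreteTopology Γ := by
  obtain ⟨V, hV, hΓV⟩ := h
  rw [discreteTopology_iff_isOpen_singleton_one, isOpen_induced_iff]
  obtain ⟨U, hUV, hUo, hU1⟩ := mem_nhds_iff.mp hV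
  refine ⟨U, hUo, ?_⟩
  ext γ
  simp only [Set.mem_preimage, Set.mem_singleton_iff]
  constructor
  · intro hγ
    exact Subtype.ext (hΓV γ γ.2 (hUV hγ))
  · rintro rfl
    exact hU1

variable [T2Space K]

/-- a subgroup with `1` isolated is closed -/
theorem isClosed_of_isolated {Γ : Subgroup (K × G₂)} (h : IsolatedOneTop Γ) : IsClosed (Γ : Set (K × G₂)) := by
  haveI := discreteTopology_of_isolated h
  exact Subgroup.isClosed_of_discrete

/-- a subgroup with `1` isolated meets every compact set in a finite set -/
theorem finite_inter_compact {Γ : Subgroup (K × G₂)} (h : IsolatedOneTop Γ) {C : Set (K × G₂)}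
    (hC : IsCompact C) : (C ∩ (Γ : Set (K × G₂))).Finite := by
  haveI := discreteTopology_of_isolated h
  apply (hC.inter_right (isClosed_of_isolated h)).finite
  exact (isDiscrete_iff_discreteTopology.mpr inferInstance).mono Set.inter_subset_right

/-! ## 2. The compact entrywise box around `1` in `SL(2,ℝ)²` -/

/-- the entrywise box of radius `1` around the identity matrix -/
def box1 : Set (Matrix (Fin 2) (Fin 2) ℝ) :=
  Set.univ.pi fun i => Set.univ.pi fun j =>
    Set.Icc ((1 : Matrix (Fin 2) (Fin 2) ℝ) i j - 1) ((1 : Matrix (Fin 2) (Fin 2) ℝ) i j + 1)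

/-- the box is compact (a product of closed intervals) -/
theorem isCompact_box1 : IsCompact box1 :=
  isCompact_univ_pi fun _ => isCompact_univ_pi fun _ => isCompact_Icc

/-- membership in the box: all entries within `1` of the identity -/
theorem mem_box1 {A : Matrix (Fin 2) (Fin 2) ℝ} :
    A ∈ box1 ↔ ∀ i j, |A i j - (1 : Matrix (Fin 2) (Fin 2) ℝ) i j| ≤ 1 := by
  constructor
  · intro h i j
    have h1 : A i ∈ Set.univ.pi fun j =>
        Set.Icc ((1 : Matrix (Fin 2) (Fin 2) ℝ) i j - 1) ((1 : Matrix (Fin 2) (Fin 2) ℝ) i j + 1) :=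
      h i (Set.mem_univ i)
    have h2 := h1 j (Set.mem_univ j)
    rw [Set.mem_Icc] at h2
    rw [abs_le]
    constructor <;> linarith [h2.1, h2.2]
  · intro h i _ j _
    rw [Set.mem_Icc]
    have := abs_le.mp (h i j)
    constructor <;> linarith

/-- `SL(2,ℝ)` is closed in the matrix space (`det = 1`) -/
theorem isClosed_det_one : IsClosed {A : Matrix (Fin 2) (Fin 2) ℝ | A.det = 1} :=
  isClosed_eq (continuous_id.matrix_det) continuous_const

/-- the box in `SL(2,ℝ)` -/
def boxSL : Set SL(2, ℝ) := (fun g : SL(2, ℝ) => (g : Matrix (Fin 2) (Fin 2) ℝ)) ⁻¹' box1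

/-- the box in `SL(2,ℝ)` is compact (closed embedding of the subtype) -/
theorem isCompact_boxSL : IsCompact boxSL :=
  (Topology.IsClosedEmbedding.subtypeVal isClosed_det_one).isCompact_preimage isCompact_box1

/-- the box in `SL(2,ℝ)²` -/
def boxG₂ : Set G₂ := boxSL ×ˢ boxSL

/-- the box in `SL(2,ℝ)²` is compact -/
theorem isCompact_boxG₂ : IsCompact boxG₂ := isCompact_boxSL.prod isCompact_boxSL

/-- membership in the box of `SL(2,ℝ)²` -/
theorem mem_boxG₂ {g : G₂} :
    g ∈ boxG₂ ↔ (∀ i j, |(g.1 : Matrix (Fin 2) (Fin 2) ℝ) i j - (1 : Matrix (Fin 2) (Fin 2) ℝ) i j| ≤ 1) ∧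
      (∀ i j, |(g.2 : Matrix (Fin 2) (Fin 2) ℝ) i j - (1 : Matrix (Fin 2) (Fin 2) ℝ) i j| ≤ 1) := by
  simp only [boxG₂, boxSL, Set.mem_prod, Set.mem_preimage, mem_box1]

/-- `1 ∈ boxG₂` -/
theorem one_mem_boxG₂ : (1 : G₂) ∈ boxG₂ := by
  rw [mem_boxG₂]
  simp

/-! ## 3. The entrywise distance from `1` and the isolation scale of the projection -/

/-- the entrywise `ℓ¹`-distance of `g ∈ SL(2,ℝ)²` from the identity -/
def d (g : G₂) : ℝ :=
  ∑ i : Fin 2, ∑ j : Fin 2, (|(g.1 : Matrix (Fin 2) (Fin 2) ℝ) i j - (1 : Matrix (Fin 2) (Fin 2) ℝ) i j| +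
    |(g.2 : Matrix (Fin 2) (Fin 2) ℝ) i j - (1 : Matrix (Fin 2) (Fin 2) ℝ) i j|)

/-- `d g = 0` forces `g = 1` -/
theorem eq_one_of_d_eq_zero {g : G₂} (h : d g = 0) : g = 1 := by
  have hterm : ∀ i ∈ (Finset.univ : Finset (Fin 2)), ∀ j ∈ (Finset.univ : Finset (Fin 2)),
      |(g.1 : Matrix (Fin 2) (Fin 2) ℝ) i j - (1 : Matrix (Fin 2) (Fin 2) ℝ) i j| +
        |(g.2 : Matrix (Fin 2) (Fin 2) ℝ) i j - (1 : Matrix (Fin 2) (Fin 2) ℝ) i j| = 0 := by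
    have h0 := (Finset.sum_eq_zero_iff_of_nonneg (fun i _ => Finset.sum_nonneg
      (fun j _ => add_nonneg (abs_nonneg _) (abs_nonneg _)))).mp h
    intro i hi j hj
    exact (Finset.sum_eq_zero_iff_of_nonneg (fun j _ => add_nonneg (abs_nonneg _) (abs_nonneg _))).mp (h0 i hi) j hj
  have h1 : ∀ i j, (g.1 : Matrix (Fin 2) (Fin 2) ℝ) i j = (1 : Matrix (Fin 2) (Fin 2) ℝ) i j := fun i j => by
    have := hterm i (Finset.mem_univ _) j (Finset.mem_univ _)
    have ha := abs_nonneg ((g.1 : Matrix (Fin 2) (Fin 2) ℝ) i j - (1 : Matrix (Fin 2) (Fin 2) ℝ) i j)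
    have hb := abs_nonneg ((g.2 : Matrix (Fin 2) (Fin 2) ℝ) i j - (1 : Matrix (Fin 2) (Fin 2) ℝ) i j)
    have : |(g.1 : Matrix (Fin 2) (Fin 2) ℝ) i j - (1 : Matrix (Fin 2) (Fin 2) ℝ) i j| = 0 := by linarith
    exact sub_eq_zero.mp (abs_eq_zero.mp this)
  have h2 : ∀ i j, (g.2 : Matrix (Fin 2) (Fin 2) ℝ) i j = (1 : Matrix (Fin 2) (Fin 2) ℝ) i j := fun i j => by
    have := hterm i (Finset.mem_univ _) j (Finset.mem_univ _)
    have ha := abs_nonneg ((g.1 : Matrix (Fin 2) (Fin 2) ℝ) i j - (1 : Matrix (Fin 2) (Fin 2) ℝ) i j)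
    have hb := abs_nonneg ((g.2 : Matrix (Fin 2) (Fin 2) ℝ) i j - (1 : Matrix (Fin 2) (Fin 2) ℝ) i j)
    have : |(g.2 : Matrix (Fin 2) (Fin 2) ℝ) i j - (1 : Matrix (Fin 2) (Fin 2) ℝ) i j| = 0 := by linarith
    exact sub_eq_zero.mp (abs_eq_zero.mp this)
  refine Prod.ext ?_ ?_
  · rw [Prod.fst_one]
    exact Matrix.SpecialLinearGroup.ext _ _ fun i j => by rw [h1 i j, Matrix.SpecialLinearGroup.coe_one]
  · rw [Prod.snd_one]
    exact Matrix.SpecialLinearGroup.ext _ _ fun i j => by rw [h2 i j, Matrix.SpecialLinearGroup.coe_one]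

/-- `d g > 0` for `g ≠ 1` -/
theorem d_pos_of_ne_one {g : G₂} (h : g ≠ 1) : 0 < d g := by
  have h0 : 0 ≤ d g := Finset.sum_nonneg fun i _ => Finset.sum_nonneg fun j _ => add_nonneg (abs_nonneg _) (abs_nonneg _)
  rcases h0.lt_or_eq with hlt | heq
  · exact hlt
  · exact absurd (eq_one_of_d_eq_zero heq.symm) h

/-- entries within `ε` of `1` in both components give `d g < 8 ε` -/
theorem d_lt_of_entries {g : G₂} {ε : ℝ}
    (h1 : ∀ i j, |(g.1 : Matrix (Fin 2) (Fin 2) ℝ) i j - (1 : Matrix (Fin 2) (Fin 2) ℝ) i j| < ε)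
    (h2 : ∀ i j, |(g.2 : Matrix (Fin 2) (Fin 2) ℝ) i j - (1 : Matrix (Fin 2) (Fin 2) ℝ) i j| < ε) : d g < 8 * ε := by
  simp only [d, Fin.sum_univ_two]
  linarith [h1 0 0, h1 0 1, h1 1 0, h1 1 1, h2 0 0, h2 0 1, h2 1 0, h2 1 1]

variable [CompactSpace K]

/-- the finite set `Γ ∩ (K × boxG₂)` -/
theorem finite_inter_box {Γ : Subgroup (K × G₂)} (h : IsolatedOneTop Γ) :
    ((Set.univ ×ˢ boxG₂) ∩ (Γ : Set (K × G₂))).Finite :=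
  finite_inter_compact h (isCompact_univ.prod isCompact_boxG₂)

open scoped Classical in
/-- **THE PROJECTION TO `SL(2,ℝ)²` HAS `1` ISOLATED ENTRYWISE** at some scale `ε₁ > 0` — the hypothesis of
`DiscreteProductCount` for `Γ.map snd` -/
theorem exists_isolated_snd {Γ : Subgroup (K × G₂)} (h : IsolatedOneTop Γ) :
    ∃ ε₁ : ℝ, 0 < ε₁ ∧ IsolatedOne₂ (Γ.map (MonoidHom.snd K G₂)) ε₁ := by
  -- the finitely many elements of `Γ` over the box with a non-trivial second component
  set F : Finset (K × G₂) := ((finite_inter_box h).toFinset).filter fun γ => γ.2 ≠ 1 with hF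
  -- an isolation scale: `1/8`, lowered below `d γ.2 / 8` for every `γ ∈ F`
  have key : ∃ ε₁ : ℝ, 0 < ε₁ ∧ ε₁ ≤ 1 / 8 ∧ ∀ γ ∈ F, 8 * ε₁ ≤ d γ.2 := by
    by_cases hne : F.Nonempty
    · obtain ⟨γ₀, hγ₀, hmin⟩ := Finset.exists_min_image F (fun γ => d γ.2) hne
      have hpos : 0 < d γ₀.2 := d_pos_of_ne_one (Finset.mem_filter.mp hγ₀).2
      refine ⟨min (1 / 8) (d γ₀.2 / 8), lt_min (by norm_num) (by linarith), min_le_left _ _, fun γ hγ => ?_⟩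
      have := hmin γ hγ
      have := min_le_right (1 / 8 : ℝ) (d γ₀.2 / 8)
      linarith
    · exact ⟨1 / 8, by norm_num, le_refl _, fun γ hγ => absurd ⟨γ, hγ⟩ hne⟩
  obtain ⟨ε₁, hε₁, hε₁8, hF'⟩ := key
  refine ⟨ε₁, hε₁, fun g hg hg1 hg2 => ?_⟩
  obtain ⟨γ, hγΓ, rfl⟩ := Subgroup.mem_map.mp hg
  simp only [MonoidHom.coe_snd] at hg1 hg2 ⊢
  by_contra hne
  have hbox : γ ∈ (Set.univ ×ˢ boxG₂) ∩ (Γ : Set (K × G₂)) := by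
    refine ⟨⟨Set.mem_univ _, ?_⟩, hγΓ⟩
    rw [mem_boxG₂]
    exact ⟨fun i j => (hg1 i j).le.trans (by linarith), fun i j => (hg2 i j).le.trans (by linarith)⟩
  have hγF : γ ∈ F := Finset.mem_filter.mpr ⟨(finite_inter_box h).mem_toFinset.mpr hbox, hne⟩
  have := hF' γ hγF
  have := d_lt_of_entries hg1 hg2
  linarith

/-! ## 4. The fibres of `Γ → Γ.map snd` are cosets of the finite kernel `Γ ∩ (K × {1})` -/

/-- the kernel `{γ ∈ Γ : γ.2 = 1}` is finite -/
theorem finite_ker {Γ : Subgroup (K × G₂)} (h : IsolatedOneTop Γ) : {γ : Γ | (γ : K × G₂).2 = 1}.Finite := by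
  have hsub : {γ : Γ | (γ : K × G₂).2 = 1} ⊆ Subtype.val ⁻¹' ((Set.univ ×ˢ boxG₂) ∩ (Γ : Set (K × G₂))) := by
    intro γ hγ
    refine ⟨⟨Set.mem_univ _, ?_⟩, γ.2⟩
    rw [Set.mem_setOf_eq] at hγ
    rw [hγ]
    exact one_mem_boxG₂
  exact ((finite_inter_box h).preimage Subtype.val_injective.injOn).subset hsub

/-- the projection `Γ → Γ.map snd` -/
def π (Γ : Subgroup (K × G₂)) (γ : Γ) : Γ.map (MonoidHom.snd K G₂) :=
  ⟨(γ : K × G₂).2, Subgroup.mem_map.mpr ⟨γ, γ.2, rfl⟩⟩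

omit [TopologicalSpace K] [IsTopologicalGroup K] [T2Space K] [CompactSpace K] in
/-- `π` is multiplicative -/
theorem π_mul (Γ : Subgroup (K × G₂)) (γ γ' : Γ) : π Γ (γ * γ') = π Γ γ * π Γ γ' := rfl

omit [TopologicalSpace K] [IsTopologicalGroup K] [T2Space K] [CompactSpace K] in
/-- `π` respects inverses -/
theorem π_inv (Γ : Subgroup (K × G₂)) (γ : Γ) : π Γ γ⁻¹ = (π Γ γ)⁻¹ := rfl

open scoped Classical in
/-- every fibre of `π` on a finset `t` has at most `m = #{γ ∈ Γ : γ.2 = 1}` elements -/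
theorem card_fibre_le {Γ : Subgroup (K × G₂)} (h : IsolatedOneTop Γ) (t : Finset Γ)
    (b : Γ.map (MonoidHom.snd K G₂)) :
    (t.filter fun γ => π Γ γ = b).card ≤ (finite_ker h).toFinset.card := by
  by_cases hne : (t.filter fun γ => π Γ γ = b).Nonempty
  · obtain ⟨γ₀, hγ₀⟩ := hne
    have hb : π Γ γ₀ = b := (Finset.mem_filter.mp hγ₀).2
    -- `γ ↦ γ γ₀⁻¹` maps the fibre injectively into the kernel
    refine Finset.card_le_card_of_injOn (fun γ => γ * γ₀⁻¹) ?_ ?_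
    · intro γ hγ
      have hγb : π Γ γ = b := (Finset.mem_filter.mp (Finset.mem_coe.mp hγ)).2
      rw [Finset.mem_coe, (finite_ker h).mem_toFinset, Set.mem_setOf_eq]
      have : π Γ (γ * γ₀⁻¹) = 1 := by rw [π_mul, π_inv, hγb, hb, mul_inv_cancel]
      have := congrArg (fun x : Γ.map (MonoidHom.snd K G₂) => (x : G₂)) this
      simpa [π] using this
    · intro γ _ γ' _ hγγ'
      exact mul_right_cancel hγγ'
  · rw [Finset.not_nonempty_iff_eq_empty.mp hne, Finset.card_empty]
    exact Nat.zero_le _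

/-! ## 5. THE COUNT for `Γ ≤ K × SL(2,ℝ)²` and the Poincaré series -/

open scoped Classical in
/-- **THE COUNT OF A DISCRETE SUBGROUP OF `K × SL(2,ℝ)²` IN THE PRODUCT SIZE OF THE `(1,1)`-FACTORS**, `β = 1 + ε'`:
`∃ C', ∀ R ≥ 0, #{γ ∈ Γ : psize γ.2 ≤ R} ≤ C' (1 + R)^(1+ε')` -/
theorem count_compact_product (Γ : Subgroup (K × G₂)) (h : IsolatedOneTop Γ) {ε' : ℝ} (hε' : 0 < ε') :
    ∃ C' : ℝ, ∀ R : ℝ, 0 ≤ R → ∃ t : Finset Γ,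
      (∀ γ : Γ, psize (γ : K × G₂).2 ≤ R → γ ∈ t) ∧ (t.card : ℝ) ≤ C' * (1 + R) ^ (1 + ε') := by
  obtain ⟨ε₁, hε₁, hiso⟩ := exists_isolated_snd h
  obtain ⟨C'', hC''⟩ := count_psize_rpow (Γ.map (MonoidHom.snd K G₂)) hε₁ hiso hε'
  set m : ℕ := (finite_ker h).toFinset.card with hm
  refine ⟨m * max C'' 0, fun R hR => ?_⟩
  obtain ⟨t', ht', hcard'⟩ := hC'' R hR
  -- the set `{γ : psize γ.2 ≤ R}` lies in the union of the fibres over `t'`, each finite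
  have hfin : {γ : Γ | psize (γ : K × G₂).2 ≤ R}.Finite := by
    have hsub : {γ : Γ | psize (γ : K × G₂).2 ≤ R} ⊆ ⋃ b ∈ t', {γ : Γ | π Γ γ = b} := by
      intro γ hγ
      rw [Set.mem_setOf_eq] at hγ
      exact Set.mem_iUnion₂.mpr ⟨π Γ γ, ht' (π Γ γ) hγ, rfl⟩
    refine (Set.Finite.biUnion t'.finite_toSet fun b _ => ?_).subset hsub
    -- each fibre injects into the finite kernel
    by_cases hne : {γ : Γ | π Γ γ = b}.Nonempty
    · obtain ⟨γ₀, hγ₀⟩ := hne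
      have hinj : Set.InjOn (fun γ : Γ => γ * γ₀⁻¹) {γ : Γ | π Γ γ = b} := fun γ _ γ' _ e => mul_right_cancel e
      refine Set.Finite.of_finite_image ((finite_ker h).subset ?_) hinj
      rintro _ ⟨γ, hγ, rfl⟩
      rw [Set.mem_setOf_eq] at hγ hγ₀ ⊢
      have : π Γ (γ * γ₀⁻¹) = 1 := by rw [π_mul, π_inv, hγ, hγ₀, mul_inv_cancel]
      have := congrArg (fun x : Γ.map (MonoidHom.snd K G₂) => (x : G₂)) this
      simpa [π] using this
    · rw [Set.not_nonempty_iff_eq_empty.mp hne]; exact Set.finite_empty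
  refine ⟨hfin.toFinset, fun γ hγ => hfin.mem_toFinset.mpr hγ, ?_⟩
  -- `#t ≤ m · #(image) ≤ m · #t'`
  have himg : hfin.toFinset.image (π Γ) ⊆ t' := by
    intro b hb
    obtain ⟨γ, hγ, rfl⟩ := Finset.mem_image.mp hb
    exact ht' _ (hfin.mem_toFinset.mp hγ)
  have h1 : hfin.toFinset.card ≤ m * (hfin.toFinset.image (π Γ)).card :=
    Finset.card_le_mul_card_image _ m fun b _ => card_fibre_le h _ b
  have h2 : (hfin.toFinset.image (π Γ)).card ≤ t'.card := Finset.card_le_card himg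
  have h3 : (hfin.toFinset.card : ℝ) ≤ (m : ℝ) * t'.card := by exact_mod_cast h1.trans (Nat.mul_le_mul_left m h2)
  calc (hfin.toFinset.card : ℝ) ≤ (m : ℝ) * t'.card := h3
    _ ≤ (m : ℝ) * (max C'' 0 * (1 + R) ^ (1 + ε')) := by
        apply mul_le_mul_of_nonneg_left _ (Nat.cast_nonneg m)
        exact hcard'.trans (mul_le_mul_of_nonneg_right (le_max_left _ _) (by positivity))
    _ = m * max C'' 0 * (1 + R) ^ (1 + ε') := by ring

variable (f : K × G₂ → ℂ)

omit [TopologicalSpace K] [IsTopologicalGroup K] [T2Space K] [CompactSpace K] in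
/-- the product size of the `(1,1)`-components has the multiplicative shift on `K × SL(2,ℝ)²` -/
theorem psize_snd_shift (x g y : K × G₂) :
    1 + psize g.2 ≤ M₂ x.2 * M₂ y.2 * (1 + psize (x⁻¹ * g * y).2) := psize_shift x.2 g.2 y.2

/-- **THE POINCARÉ-SERIES KERNEL OF A DISCRETE SUBGROUP OF `K × SL(2,ℝ)²` IS CONTINUOUS** for every continuous `f` with
`‖f g‖ ≤ C (1 + psize g.2)^(−α)`, `α > 1` -/
theorem continuous_kernelSum_compact_product (hfc : Continuous f) (Γ : Subgroup (K × G₂)) (h : IsolatedOneTop Γ)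
    {α : ℝ} (hα : 1 < α) {C : ℝ} (hf : ∀ g, ‖f g‖ ≤ C * (1 + psize g.2) ^ (-α)) :
    Continuous (fun p : (K × G₂) × (K × G₂) =>
      PoincareKernel.kernelSum (fun γ : Γ => (γ : K × G₂)) f p.1 p.2) := by
  have hε' : 0 < (α - 1) / 2 := by linarith
  obtain ⟨C', hC'⟩ := count_compact_product Γ h hε'
  exact PoincareKernel.continuous_kernelSum_of_mul (fun g : K × G₂ => psize g.2) (fun γ : Γ => (γ : K × G₂)) f hfc
    (M := fun x => M₂ x.2) (fun x => M₂_nonneg x.2)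
    (PoincareKernel.size_locBdd_of_continuous (fun x : K × G₂ => M₂ x.2) (continuous_M₂.comp continuous_snd))
    (fun g => psize_nonneg g.2) psize_snd_shift (β := 1 + (α - 1) / 2) (by linarith) (by linarith) hC' hf

/-- absolute convergence at every point -/
theorem summable_norm_kernel_compact_product (Γ : Subgroup (K × G₂)) (h : IsolatedOneTop Γ)
    {α : ℝ} (hα : 1 < α) {C : ℝ} (hf : ∀ g, ‖f g‖ ≤ C * (1 + psize g.2) ^ (-α)) (x y : K × G₂) :
    Summable fun γ : Γ => ‖f (x⁻¹ * (γ : K × G₂) * y)‖ := by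
  have hε' : 0 < (α - 1) / 2 := by linarith
  obtain ⟨C', hC'⟩ := count_compact_product Γ h hε'
  exact PoincareKernel.summable_norm_shift_of_mul (fun g : K × G₂ => psize g.2) (fun γ : Γ => (γ : K × G₂)) f
    (fun g => psize_nonneg g.2) (M := fun x => M₂ x.2) (fun x => M₂_nonneg x.2) psize_snd_shift
    (β := 1 + (α - 1) / 2) (by linarith) (by linarith) hC' hf x y

omit [TopologicalSpace K] [Group K] [IsTopologicalGroup K] [T2Space K] [CompactSpace K] in
/-- the line's archimedean test function: bounded on the compact factor, the two `(1,1)`-coefficients with the decay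
`(1 + κ)^(−α)` — it has the decay `(1 + psize g.2)^(−α)` -/
theorem norm_three_le {f₁ : K → ℂ} {f₂ f₃ : SL(2, ℝ) → ℂ} {C₁ C₂ C₃ α : ℝ} (h₁ : ∀ k, ‖f₁ k‖ ≤ C₁)
    (h₂ : ∀ g, ‖f₂ g‖ ≤ C₂ * (1 + κ g) ^ (-α)) (h₃ : ∀ g, ‖f₃ g‖ ≤ C₃ * (1 + κ g) ^ (-α)) (g : K × G₂) :
    ‖f₁ g.1 * (f₂ g.2.1 * f₃ g.2.2)‖ ≤ (C₁ * (C₂ * C₃)) * (1 + psize g.2) ^ (-α) := by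
  have hC₁ : 0 ≤ C₁ := (norm_nonneg _).trans (h₁ g.1)
  have hprod := norm_prod_le h₂ h₃ g.2
  rw [norm_mul]
  calc ‖f₁ g.1‖ * ‖f₂ g.2.1 * f₃ g.2.2‖ ≤ C₁ * ((C₂ * C₃) * (1 + psize g.2) ^ (-α)) :=
        mul_le_mul (h₁ g.1) hprod (norm_nonneg _) hC₁
    _ = (C₁ * (C₂ * C₃)) * (1 + psize g.2) ^ (-α) := by ring

/-- **THE LINE'S ARCHIMEDEAN KERNEL ON `K × SL(2,ℝ)²`**: for a discrete `Γ ≤ K × SL(2,ℝ)²`, `f₁` bounded continuous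
on the compact factor and `f₂, f₃` continuous with `‖f_j g‖ ≤ C_j (1 + κ g)^(−α)`, `α > 1`, the Poincaré series
`Σ_{γ ∈ Γ} f₁(..) f₂(..) f₃(..)` at `(x⁻¹ γ y)` is continuous on `(K × SL(2,ℝ)²)²`. -/
theorem continuous_kernelSum_compact_product_three (Γ : Subgroup (K × G₂)) (h : IsolatedOneTop Γ)
    {f₁ : K → ℂ} {f₂ f₃ : SL(2, ℝ) → ℂ} (hc₁ : Continuous f₁) (hc₂ : Continuous f₂) (hc₃ : Continuous f₃)
    {C₁ C₂ C₃ α : ℝ} (hα : 1 < α) (h₁ : ∀ k, ‖f₁ k‖ ≤ C₁) (h₂ : ∀ g, ‖f₂ g‖ ≤ C₂ * (1 + κ g) ^ (-α))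
    (h₃ : ∀ g, ‖f₃ g‖ ≤ C₃ * (1 + κ g) ^ (-α)) :
    Continuous (fun p : (K × G₂) × (K × G₂) => PoincareKernel.kernelSum (fun γ : Γ => (γ : K × G₂))
      (fun g : K × G₂ => f₁ g.1 * (f₂ g.2.1 * f₃ g.2.2)) p.1 p.2) :=
  continuous_kernelSum_compact_product (fun g : K × G₂ => f₁ g.1 * (f₂ g.2.1 * f₃ g.2.2))
    ((hc₁.comp continuous_fst).mul ((hc₂.comp (continuous_fst.comp continuous_snd)).mul
      (hc₃.comp (continuous_snd.comp continuous_snd)))) Γ h hα (norm_three_le h₁ h₂ h₃)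

end

end Summit.Ventures.HodgeRepro2.Tier7.Line3.DiscreteCompactFactor
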